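import Mathlib
import Literature.Computability.AlgebraicComplexity.NestFreeMatchingPoly
import Summits.ValiantsHypothesis.ValiantsHypothesis.Theorems.FifoMatchingNFPolytopeQueueGridPPHardOfCorGridMinor
import Summits.ValiantsHypothesis.ValiantsHypothesis.Theorems.FifoMatchingNFPolytopeQueueGridFaceProjection
import HarnessLib

/-!
# A1 DISCHARGED — the 0/1 points of the queue-grid face of `NFP_n` read out EXACTLY onto the pattern vectors — Theorems-side port,
# def-free

Port to `Theorems/` (val-lit desk g12 RULING #273 (a): val-port-4 = S-port successor hand; director-valiant g12 R193 (b)) of the A1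
DISCHARGE of val-idea-7 g7's line workfile `Cruxes/NNLinearDegreeCofactorHard/Lines/shadow_division.lean` rev 8 §A1Discharge (tree
60866a09ab09), bodies VERBATIM: `zeroOnePoints_of_gadget_prop` (the POINT form of c1 g5's face–projection reduction
`QueueGridFace.face_projection_of_gadget_prop`, p612281: under (h1) designs are nest-free perfect matchings, (h2) supported on `E'`, (h3)
RIGIDITY, (h4) `Prop` read-out, the 0/1 POINTS of `supp NN_n` on the coordinate face `{x_a = 0 : a ∉ E'}` are mapped by `x ↦ x ∘ f`
EXACTLY onto the pattern vectors) and **`queueGridZeroOnePoints_holds`** = the line's A1 `QueueGridZeroOnePoints` — stated by its TEXT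
(crit-3 #21b (a): no fresh `Prop` defs Theorems-side) — from val-width-26254-qg1 g0's landed layout-B gadget facts
(`design_mem_nestFreeMatchings`, `design_mem_allowed`, RIGIDITY `exists_design_eq`, read-out `coordMap_arc_iff`; the same instantiation
as the landed `queueGridFaceProjection`, p617795).  With this, T2 `GridCorShadow.faceLift` (sibling `…GridCorShadowCoordinateFace`) is
UNCONDITIONAL in A1, and the line `shadow_division` rests on item 27045 `GridCorCliqueFace` ALONE.

HONEST FRAMING: helper layer (`--supports stmt-ValiantsHypothesis-27045 --as helper`); 27045 OPEN; K1 conditional; no rung of record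
moves; nothing here bears on `VP ≠ VNP`, which is NOT proved; no summit statement is proved by this seat. [folklore assembly]
-/

set_option autoImplicit false

-- the mandated summit-side namespace repeats a component by design (single-problem summit)
set_option linter.dupNamespace false

open MvPolynomial Literature.Computability.AlgebraicComplexity
open scoped NNReal Pointwise

namespace Summit.ValiantsHypothesis.ValiantsHypothesis.Theorems.FifoMatching

namespace GridCorShadow

open Summit.ValiantsHypothesis.ValiantsHypothesis.Theorems.FifoMatching.QueueGridFace
  (realOf suppPts QGV qgEdge patternVec)

noncomputable section


open Summit.ValiantsHypothesis.ValiantsHypothesis.Theorems.FifoMatching.QueueGridFace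
  (realSupport_nestFreeMatchingPoly arcExponent_arc arc_of_arcExponent_ne_zero)
open Summit.ValiantsHypothesis.ValiantsHypothesis.Theorems.FifoMatching.NFPolytopeQuasiPolyXC.QueueGridFace
  (half coordMap design_mem_nestFreeMatchings design_mem_allowed exists_design_eq coordMap_arc_iff)

/-- **Point form of the face–projection reduction (rev 8; the A1 glue, formerly price P2).**  Gadget data exactly as in
c1 g5's `QueueGridFace.face_projection_of_gadget_prop` (p612281) — (h1) designs are nest-free perfect matchings, (h2)
supported on `E'`, (h3) RIGIDITY, (h4) `Prop` read-out: then the 0/1 POINTS of `supp NN_n` on the coordinate face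
`{x_a = 0 : a ∉ E'}` are mapped by `x ↦ x ∘ f` EXACTLY onto the pattern vectors `X ↦ (q ↦ [C X q])`.  (c1's theorem is the
convex-HULL form; the shadow lift T2 needs the points, HY21 Lemma 10.) [folklore assembly] -/
theorem zeroOnePoints_of_gadget_prop {n : ℕ} {β κ : Type*}
    (dsg : β → (Fin (2 * n) → Fin (2 * n))) (E' : Set (Fin (2 * n) × Fin (2 * n)))
    (f : κ → Fin (2 * n) × Fin (2 * n)) (C : β → κ → Prop) [∀ X q, Decidable (C X q)]
    (h1 : ∀ X, dsg X ∈ nestFreeMatchings (2 * n))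
    (h2 : ∀ X i, i < dsg X i → (i, dsg X i) ∈ E')
    (h3 : ∀ M ∈ nestFreeMatchings (2 * n), (∀ i, i < M i → (i, M i) ∈ E') → ∃ X, dsg X = M)
    (h4 : ∀ X q, ((f q).1 < dsg X (f q).1 ∧ dsg X (f q).1 = (f q).2) ↔ C X q) :
    ∃ Z : Finset (Fin (2 * n) × Fin (2 * n)),
      (fun x : (Fin (2 * n) × Fin (2 * n)) → ℝ => x ∘ f) ''
          (suppPts (nestFreeMatchingPoly n ℝ≥0) ∩ {x | ∀ e ∈ Z, x e = 0})
        = Set.range (fun (X : β) (q : κ) => if C X q then (1 : ℝ) else 0) := by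
  classical
  let χ : (Fin (2 * n) → Fin (2 * n)) → (Fin (2 * n) × Fin (2 * n)) → ℝ :=
    fun M i => ((arcExponent M i : ℕ) : ℝ)
  refine ⟨Finset.univ.filter fun a => a ∉ E', ?_⟩
  -- the real support points are the `χ_M` (c1's `realSupport_nestFreeMatchingPoly`)
  have hsupp : suppPts (nestFreeMatchingPoly n ℝ≥0)
      = χ '' (nestFreeMatchings (2 * n) : Set (Fin (2 * n) → Fin (2 * n))) := by
    show (fun d : (Fin (2 * n) × Fin (2 * n)) →₀ ℕ => fun i : Fin (2 * n) × Fin (2 * n) => ((d i : ℕ) : ℝ)) ''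
        ((nestFreeMatchingPoly n ℝ≥0).support : Set ((Fin (2 * n) × Fin (2 * n)) →₀ ℕ)) = _
    rw [realSupport_nestFreeMatchingPoly]
  -- the read-out as values of `χ`
  have hread : ∀ X q, χ (dsg X) (f q) = if C X q then (1 : ℝ) else 0 := by
    intro X q
    have happ := arcExponent_apply (dsg X) (f q).1 (f q).2
    rw [Prod.mk.eta] at happ
    simp only [χ, happ]
    by_cases hC : C X q
    · rw [if_pos ((h4 X q).2 hC), if_pos hC, Nat.cast_one]
    · rw [if_neg (fun h => hC ((h4 X q).1 h)), if_neg hC, Nat.cast_zero]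
  rw [hsupp]
  ext y
  simp only [Set.mem_image, Set.mem_inter_iff, Set.mem_setOf_eq, Finset.mem_filter, Finset.mem_univ, true_and,
    Set.mem_range]
  constructor
  · rintro ⟨x, ⟨⟨M, hM, rfl⟩, hx0⟩, rfl⟩
    have harcs : ∀ i, i < M i → (i, M i) ∈ E' := by
      intro i hi
      by_contra hni
      have h0 := hx0 (i, M i) hni
      simp only [χ, arcExponent_arc M hi, Nat.cast_one] at h0
      exact one_ne_zero h0
    obtain ⟨X, hX⟩ := h3 M (Finset.mem_coe.1 hM) harcs
    refine ⟨X, ?_⟩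
    funext q
    rw [← hX]
    exact (hread X q).symm
  · rintro ⟨X, rfl⟩
    refine ⟨χ (dsg X), ⟨⟨dsg X, Finset.mem_coe.2 (h1 X), rfl⟩, fun e he => ?_⟩, ?_⟩
    · simp only [χ, Nat.cast_eq_zero]
      by_contra hne
      obtain ⟨hlt, heq⟩ := arc_of_arcExponent_ne_zero (dsg X) hne
      have hmem := h2 X _ hlt
      rw [heq, Prod.mk.eta] at hmem
      exact he hmem
    · funext q
      exact hread X q

/-- **A1 `QueueGridZeroOnePoints` DISCHARGED (rev 8)** from val-width-26254-qg1 g0's landed layout-B gadget facts — the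
same instantiation as the landed `queueGridFaceProjection` (p617795): designs `design d X`
(`design_mem_nestFreeMatchings`), allowed arcs `allowed r d` (`design_mem_allowed`), RIGIDITY `exists_design_eq`,
read-out `coordMap_arc_iff`.  No item needed (tenure, vw l.1281: A1 is a stub, not itemised). -/
theorem queueGridZeroOnePoints_holds :
    ∀ r n : ℕ, 1 ≤ r → (r + 1) * (2 * r + 1) ≤ n →
      ∃ (Z : Finset (Fin (2 * n) × Fin (2 * n)))
        (f : (QGV r × QGV r) × Bool × Bool → Fin (2 * n) × Fin (2 * n)),
        (fun x : (Fin (2 * n) × Fin (2 * n)) → ℝ => x ∘ f) ''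
            (suppPts (nestFreeMatchingPoly n ℝ≥0) ∩ {x | ∀ e ∈ Z, x e = 0}) = Set.range (patternVec r) := by
  intro r n _ hn
  obtain ⟨d, rfl⟩ := Nat.exists_eq_add_of_le hn
  obtain ⟨Z, h⟩ := zeroOnePoints_of_gadget_prop (n := half r d)
    (Summit.ValiantsHypothesis.ValiantsHypothesis.Theorems.FifoMatching.NFPolytopeQuasiPolyXC.QueueGridFace.design d)
    (Summit.ValiantsHypothesis.ValiantsHypothesis.Theorems.FifoMatching.NFPolytopeQuasiPolyXC.QueueGridFace.allowed r d :
      Set (Fin (2 * half r d) × Fin (2 * half r d))) (coordMap r d)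
    (fun X q => qgEdge r q.1 = true ∧ X q.1.1 = q.2.1 ∧ X q.1.2 = q.2.2)
    (fun X => design_mem_nestFreeMatchings X)
    (fun X i hi => Finset.mem_coe.2 (design_mem_allowed X i hi))
    (fun M hM hE => exists_design_eq M hM fun p hp => Finset.mem_coe.1 (hE p hp))
    (fun X q => coordMap_arc_iff X q)
  exact ⟨Z, coordMap r d, h⟩

end

end GridCorShadow

end Summit.ValiantsHypothesis.ValiantsHypothesis.Theorems.FifoMatching
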